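import Literature.AnabelianGeometry.AbsoluteAnabelian.AbsTopII.InertiaDecompositionProofs

/-!
# Kernel DAG index — layer X = MIXED delta (L4 ×1; one file per cycle under the live-queue discipline), part zk (GENERATED by abc-iut-c312-2 gen 11 `work/gen_index.py` @2026-08-29T08:02Z from HOME/plan/DAG.tsv +
KERNEL-DAG-MODULES.tsv (regenerated 2026-08-29T08:02:06Z): 1 landed/discharged nodes NOT YET in the tree index Summits/ABC/IUTFork/DAG*.lean; spec v1.3 §2 (M))

THIS FILE PROVES NOTHING NEW AND ASSERTS NOTHING (HOME/plan/KERNEL-DAG-SPEC.md). It gives ONE NAME `N_<kernel_id>` to each DAG node whose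
statement has LANDED through the gate, knitting the landed declarations BY NAME: claim nodes `N_<id> : Prop := StatementOf @thm₁ ∧ …` (one
conjunct per landed theorem the DAG row names, universe levels instantiated explicitly per the spec's UNIVERSE RULE, arities read off the farm),
witnessed `N_<id>_holds` iff the DAG row is `discharged(p…)` and `N_<id>_part` otherwise (spec §2(b),(c); c312-2 F1/F2); data nodes
`abbrev N_<id> := @<primary>` with the row's further declarations as `example := @…` lines; FACT-style `def … : Prop` declarations are data
here (a NAME, never asserted). Decl lists come from the `decls` column of plan/DAG.tsv as resolved against the tree sources (unresolvable
tokens dropped and reported to abc-iut-dag on STATUS). Nothing here says abc is proved or refuted or takes a side on [IUTchIII] Cor 3.12.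
typed ≠ discharged; indexed ≠ endorsed.
-/

namespace Summit.ABC.IUTFork.DAG

namespace PartXzk
/-- `StatementOf h` is the statement (a `Prop`) of which the landed `h` is the proof: the index NAMES statements, it never re-types them. -/
abbrev StatementOf {P : Prop} (_h : P) : Prop := P
end PartXzk
open PartXzk

noncomputable section
universe u₁ u₂ u₃ u₄ u₅ u₆ u₇ u₈ u₉ u₁₀ u₁₁ u₁₂ u₁₃ u₁₄ u₁₅ u₁₆


/-- [node AbsTopII:Prop1.3/v · L4/ · p.12 · p425615 · claim · DAG status discharged(p425615)] decls 2 · KID naming: sub-DAG (B) row of [AbsTopII] Prop 1.3 (v) (plan/L4/SUBDAG-AbsTopII-Prop13.md; dischargers by name `DPSCData.prop13v_of_inputs`, `DPSCIndexData.prop13v_of_prop_1_3_iii'`, status discharged(p425615)); the item's data node `N_AbsTopII_Prop1_3_v` (landed(p404475)) is NOT this node, nor is the sub row `N_AbsTopII_Prop1_3_v'`; the synthesised id `N_AbsTopII_Prop1_3_v` collided with the item node (dag 2026-08-28T07:37:42Z «needs a naming word»); id `N_AbsTopII_Prop1_3_vB` proposed by the filer (abc-iut-c312-2 g14, L4 lineage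 by RULINGS #352, c87 07:06:27Z) with no L4 chair seated — an L4 chair NAMING WORD supersedes it per KERNEL-DAG-SPEC §7 (a)/(h)(2) (superseding sibling, never an edit); dag g12 NO OBJECTION / NO HOLD 2026-08-29T07:10:56Z (conditions (i)–(v) there; DAG.tsv col 21 adopts the id mechanically after INDEX-NAMES lists it; count-neutral) · cites→ v.1, v.2, v.4 -/
def N_AbsTopII_Prop1_3_vB : Prop :=
  StatementOf @Literature.AnabelianGeometry.AbsoluteAnabelian.DPSCData.prop13v_of_inputs.{u₁} ∧
  StatementOf @Literature.AnabelianGeometry.AbsoluteAnabelian.AbsTopII.DPSCIndexData.prop13v_of_prop_1_3_iii'.{u₁}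
/-- discharge of `N_AbsTopII_Prop1_3_vB`: the landed theorems it names, BY NAME (spec §2(c)); proves nothing new. -/
theorem N_AbsTopII_Prop1_3_vB_holds : N_AbsTopII_Prop1_3_vB := ⟨@Literature.AnabelianGeometry.AbsoluteAnabelian.DPSCData.prop13v_of_inputs, @Literature.AnabelianGeometry.AbsoluteAnabelian.AbsTopII.DPSCIndexData.prop13v_of_prop_1_3_iii'⟩

end

end Summit.ABC.IUTFork.DAG
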